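import Summits.HodgeConjecture.CorCM.PointwiseConjugationCMFieldsHodge
import HarnessLib

/-!
# Pointwise partial conjugations: descent to CM subfields, and the obstruction from a shared totally complex subfield

COR-CM (cell `pub-hodgecm2`, binder seat `b16` gen 48, count-neutral claim PTCONJ, file F5; theorems only, no
definition, no named fact, no `sorry`).  NEW as stated, hence under `Summits/`.  HONEST FRAMING: structural lemmas
about the criterion (PC) of `PointwiseConjugationCMFieldsHodge`; `HC_CM` is neither used nor asserted.

(PC) for a pair of CM fields `(K_a, K_b)`: every pair of embeddings `x : K_a → ℂ`, `y : K_b → ℂ` admits `σ ∈ Aut(ℂ)`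
with `σ ∘ x = x̄` and `σ ∘ y = y`; it is EQUIVALENT to the absence of common constituents of the two slots (this seat's
`PointwiseConjugationSlots[Converse]`).  Two structural facts, both immediate from the definition and both useful
in a census:

* §1 **DESCENT** (`pointwiseConj_of_ringHom_right`, `pointwiseConj_of_ringHom_left`): (PC) for `(K_a, K_b')` implies
  (PC) for `(K_a, K_b)` whenever `K_b ↪ K_b'` (and symmetrically in the first slot): an obstruction found on a CM
  subfield persists in every CM overfield.  (Representation side: `Anti(Hom(K_b, ℂ))` is a quotient of
  `Anti(Hom(K_b', ℂ))`.)
* §2 **SHARED TOTALLY COMPLEX SUBFIELD** (`not_pointwiseConj_of_shared_subfield`): if a totally complex number field `k`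
  embeds in both `K_a` and `K_b` (an imaginary quadratic field; a common CM subfield of any degree; `K_a ↪ K_b`
  itself, `not_pointwiseConj_of_ringHom`), then (PC) FAILS: aligning `y₀` with `x` on `k` (transitivity of `Aut(ℂ)` on
  `Hom(k, ℂ)`), a `σ` with `σ ∘ x = x̄`, `σ ∘ y₀ = y₀` would make the embedding `x|_k` real.  Hence
  (`not_pairwise_of_shared_subfield`) for NONDEGENERATE types the slots DO have a common constituent — the pairwise
  route to additivity is closed (for an ABELIAN `k` the pair is in fact degenerate, `CommonAbelianCMSubfieldDegenerate`;
  for non-abelian `k` it need not be, e.g. the dihedral reflex pairs).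

## References

* [Gordon1999HodgeAVSurvey] B. B. Gordon, *A survey of the Hodge conjecture for abelian varieties*, §3 Theorem (Imai,
  Murty) with proof; 7.5–7.7.
* [MoonenZarhin1999LowDim] B. Moonen, Yu. Zarhin, *Hodge classes on abelian varieties of low dimension*, Math. Ann.
  315 (1999), Thm. (0.2) (a) ("`k ↪ End⁰`").
* [Lang2002] S. Lang, *Algebra*, GTM 211, V §2 Thm. 2.8.
-/

noncomputable section

open NumberField NumberField.ComplexEmbedding IntermediateField
open scoped BigOperators

namespace Summit.HodgeConjecture.CorCM

open Literature.NumberTheory.ComplexMultiplication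
open Literature.AlgebraicGeometry.Motives (CMType)
open Literature.AlgebraicGeometry.Pohlmann1968

/-! ## §1 Descent of pointwise partial conjugations to CM subfields -/

section Descent

variable {I : Type} {K : I → Type} [∀ i, Field (K i)] [∀ i, NumberField (K i)] [∀ i, IsCMField (K i)]

omit [∀ i, NumberField (K i)] [∀ i, IsCMField (K i)] in
/-- **Descent in the second slot.**  If `e : K_b ↪ K_{b'}` and (PC) holds for `(K_a, K_{b'})`, then (PC) holds for
`(K_a, K_b)`: for `y : K_b → ℂ` extend to `y' : K_{b'} → ℂ` with `y' ∘ e = y` (given as the hypothesis `hext`, always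
available for number fields) and use the `σ` of `(x, y')`. [cite: Lang2002, V §2 Thm. 2.8] -/
theorem pointwiseConj_of_ringHom_right {a b b' : I} (e : K b →+* K b')
    (hext : ∀ y : K b →+* ℂ, ∃ y' : K b' →+* ℂ, y'.comp e = y)
    (hpt : ∀ (x : K a →+* ℂ) (y' : K b' →+* ℂ), ∃ σ : ℂ ≃+* ℂ, σ • x = (starRingAut : ℂ ≃+* ℂ) • x ∧ σ • y' = y') :
    ∀ (x : K a →+* ℂ) (y : K b →+* ℂ), ∃ σ : ℂ ≃+* ℂ, σ • x = (starRingAut : ℂ ≃+* ℂ) • x ∧ σ • y = y := by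
  intro x y
  obtain ⟨y', rfl⟩ := hext y
  obtain ⟨σ, hσx, hσy⟩ := hpt x y'
  refine ⟨σ, hσx, RingHom.ext fun w => ?_⟩
  rw [ringEquiv_smul_apply, RingHom.comp_apply, ← ringEquiv_smul_apply σ y' (e w), hσy]

omit [∀ i, NumberField (K i)] [∀ i, IsCMField (K i)] in
/-- **Descent in the first slot.**  If `e : K_a ↪ K_{a'}` and (PC) holds for `(K_{a'}, K_b)`, then (PC) holds for
`(K_a, K_b)` (`σ ∘ x' = x̄'` restricts along `e`). [cite: Lang2002, V §2 Thm. 2.8] -/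
theorem pointwiseConj_of_ringHom_left {a a' b : I} (e : K a →+* K a')
    (hext : ∀ x : K a →+* ℂ, ∃ x' : K a' →+* ℂ, x'.comp e = x)
    (hpt : ∀ (x' : K a' →+* ℂ) (y : K b →+* ℂ), ∃ σ : ℂ ≃+* ℂ, σ • x' = (starRingAut : ℂ ≃+* ℂ) • x' ∧ σ • y = y) :
    ∀ (x : K a →+* ℂ) (y : K b →+* ℂ), ∃ σ : ℂ ≃+* ℂ, σ • x = (starRingAut : ℂ ≃+* ℂ) • x ∧ σ • y = y := by
  intro x y
  obtain ⟨x', rfl⟩ := hext x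
  obtain ⟨σ, hσx, hσy⟩ := hpt x' y
  refine ⟨σ, RingHom.ext fun w => ?_, hσy⟩
  rw [ringEquiv_smul_apply, RingHom.comp_apply, ← ringEquiv_smul_apply σ x' (e w), hσx, ringEquiv_smul_apply,
    ringEquiv_smul_apply, RingHom.comp_apply]

omit [∀ i, IsCMField (K i)] in
/-- **Embeddings extend along `K_b ↪ K_{b'}`** (number fields; `Aut(ℂ)` is transitive on `Hom(K_b, ℂ)`): for every
`y : K_b → ℂ` some `y' : K_{b'} → ℂ` has `y' ∘ e = y`. [cite: Lang2002, V §2 Thm. 2.8] -/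
theorem exists_ringHom_comp_eq {b b' : I} (e : K b →+* K b') (y : K b →+* ℂ) :
    ∃ y' : K b' →+* ℂ, y'.comp e = y := by
  haveI := isPretransitive_ringEquiv_complex (K := K b)
  obtain ⟨y₁⟩ : Nonempty (K b' →+* ℂ) := inferInstance
  obtain ⟨τ, hτ⟩ := MulAction.exists_smul_eq (ℂ ≃+* ℂ) (y₁.comp e) y
  refine ⟨τ • y₁, RingHom.ext fun w => ?_⟩
  rw [RingHom.comp_apply, ringEquiv_smul_apply, ← hτ, ringEquiv_smul_apply, RingHom.comp_apply]

omit [∀ i, IsCMField (K i)] in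
/-- **Descent, number-field form**: (PC) for `(K_a, K_{b'})` ⟹ (PC) for `(K_a, K_b)` whenever `K_b ↪ K_{b'}`.
[cite: Lang2002, V §2 Thm. 2.8] -/
theorem pointwiseConj_of_ringHom_right' {a b b' : I} (e : K b →+* K b')
    (hpt : ∀ (x : K a →+* ℂ) (y' : K b' →+* ℂ), ∃ σ : ℂ ≃+* ℂ, σ • x = (starRingAut : ℂ ≃+* ℂ) • x ∧ σ • y' = y') :
    ∀ (x : K a →+* ℂ) (y : K b →+* ℂ), ∃ σ : ℂ ≃+* ℂ, σ • x = (starRingAut : ℂ ≃+* ℂ) • x ∧ σ • y = y :=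
  pointwiseConj_of_ringHom_right e (exists_ringHom_comp_eq e) hpt

omit [∀ i, IsCMField (K i)] in
/-- **Descent, number-field form, first slot**: (PC) for `(K_{a'}, K_b)` ⟹ (PC) for `(K_a, K_b)` whenever `K_a ↪ K_{a'}`.
[cite: Lang2002, V §2 Thm. 2.8] -/
theorem pointwiseConj_of_ringHom_left' {a a' b : I} (e : K a →+* K a')
    (hpt : ∀ (x' : K a' →+* ℂ) (y : K b →+* ℂ), ∃ σ : ℂ ≃+* ℂ, σ • x' = (starRingAut : ℂ ≃+* ℂ) • x' ∧ σ • y = y) :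
    ∀ (x : K a →+* ℂ) (y : K b →+* ℂ), ∃ σ : ℂ ≃+* ℂ, σ • x = (starRingAut : ℂ ≃+* ℂ) • x ∧ σ • y = y :=
  pointwiseConj_of_ringHom_left e (exists_ringHom_comp_eq e) hpt

end Descent

/-! ## §2 A shared totally complex subfield obstructs -/

section Shared

variable {I : Type} {K : I → Type} [∀ i, Field (K i)] [∀ i, NumberField (K i)] [∀ i, IsCMField (K i)]
variable {k : Type} [Field k] [NumberField k]

omit [∀ i, IsCMField (K i)] in
/-- **A shared totally complex subfield kills (PC).**  If a totally complex number field `k` embeds in `K_a` by `e_a` and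
in `K_b` by `e_b`, then NOT every pair `(x, y)` admits `σ ∈ Aut(ℂ)` with `σ ∘ x = x̄`, `σ ∘ y = y`: choose `y₀` with
`y₀ ∘ e_b = x ∘ e_a` (transitivity on `Hom(k, ℂ)`); then `σ ∘ (x ∘ e_a)` would be both `\overline{x ∘ e_a}` and
`x ∘ e_a`, a real embedding of `k`. [cite: MoonenZarhin1999LowDim, Thm. (0.2) (a)] [cite: Gordon1999HodgeAVSurvey, §3 Theorem (proof)] -/
theorem not_pointwiseConj_of_shared_subfield [IsTotallyComplex k] {a b : I} (ea : k →+* K a) (eb : k →+* K b) :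
    ¬ ∀ (x : K a →+* ℂ) (y : K b →+* ℂ), ∃ σ : ℂ ≃+* ℂ, σ • x = (starRingAut : ℂ ≃+* ℂ) • x ∧ σ • y = y := by
  intro hpt
  haveI := isPretransitive_ringEquiv_complex (K := k)
  obtain ⟨x⟩ : Nonempty (K a →+* ℂ) := inferInstance
  obtain ⟨y₁⟩ : Nonempty (K b →+* ℂ) := inferInstance
  -- align `y₀` with `x` on `k`
  obtain ⟨τ, hτ⟩ := MulAction.exists_smul_eq (ℂ ≃+* ℂ) (y₁.comp eb) (x.comp ea)
  set y₀ : K b →+* ℂ := τ • y₁ with hy₀_def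
  have hy₀ : y₀.comp eb = x.comp ea := by
    refine RingHom.ext fun w => ?_
    rw [RingHom.comp_apply, hy₀_def, ringEquiv_smul_apply, ← hτ, ringEquiv_smul_apply, RingHom.comp_apply]
  obtain ⟨σ, hσx, hσy⟩ := hpt x y₀
  -- `x ∘ e_a` would be real
  have hreal : ComplexEmbedding.IsReal (x.comp ea) := by
    rw [ComplexEmbedding.isReal_iff]
    refine RingHom.ext fun w => ?_
    rw [ComplexEmbedding.conjugate_coe_eq, RingHom.comp_apply]
    have h1 := RingHom.congr_fun hσx (ea w)
    rw [ringEquiv_smul_apply, ringEquiv_smul_apply, starRingAut_apply, ← starRingEnd_apply] at h1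
    -- `h1 : σ (x (ea w)) = conj (x (ea w))`
    have h2 := RingHom.congr_fun hσy (eb w)
    rw [ringEquiv_smul_apply] at h2
    -- `h2 : σ (y₀ (eb w)) = y₀ (eb w)`, and `y₀ (eb w) = x (ea w)`
    have h3 : y₀ (eb w) = x (ea w) := by
      have := RingHom.congr_fun hy₀ w
      rwa [RingHom.comp_apply, RingHom.comp_apply] at this
    rw [h3] at h2
    rw [← h1, h2]
  exact IsTotallyComplex.complexEmbedding_not_isReal (x.comp ea) hreal

/-- **An embedding `K_a ↪ K_b` kills (PC)** (`k = K_a`, totally complex as a CM field; isomorphic fields in particular;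
by the symmetry of (PC) also `K_b ↪ K_a`). [cite: MoonenZarhin1999LowDim, Thm. (0.2) (a)] -/
theorem not_pointwiseConj_of_ringHom {a b : I} (e : K a →+* K b) :
    ¬ ∀ (x : K a →+* ℂ) (y : K b →+* ℂ), ∃ σ : ℂ ≃+* ℂ, σ • x = (starRingAut : ℂ ≃+* ℂ) • x ∧ σ • y = y :=
  not_pointwiseConj_of_shared_subfield (RingHom.id (K a)) e

/-- **Nondegenerate types over fields with a shared totally complex subfield DO have a common constituent**: the
hypothesis `hpair` of the pairwise criterion fails for `(a, b)` (so additivity, if it holds, is a matter of type-vector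
position — it does hold for the dihedral reflex pairs, it fails for every shared ABELIAN CM subfield).
[cite: Gordon1999HodgeAVSurvey, 7.5–7.7] [cite: MoonenZarhin1999LowDim, Thm. (0.2) (a)] -/
theorem not_pairwise_of_shared_subfield [IsTotallyComplex k] (Φ : ∀ i, CMType (K i)) {a b : I}
    (ha : IsNondegenerate (Φ a)) (hb : IsNondegenerate (Φ b)) (ea : k →+* K a) (eb : k →+* K b) :
    ¬ ∀ P : Submodule ℚ ((K a →+* ℂ) → ℚ), P ≤ antiSpan (ℂ ≃+* ℂ) (Φ a).1 →
      (∀ g : ℂ ≃+* ℂ, ∀ f ∈ P, (fun x => f (g • x)) ∈ P) →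
      ∀ T : ((K a →+* ℂ) → ℚ) →ₗ[ℚ] ((K b →+* ℂ) → ℚ),
        (∀ g : ℂ ≃+* ℂ, ∀ f ∈ P, T (fun x => f (g • x)) = fun y => T f (g • y)) →
        (∀ f ∈ P, T f ∈ antiSpan (ℂ ≃+* ℂ) (Φ b).1) → (∀ f ∈ P, T f = 0 → f = 0) → P = ⊥ := by
  rw [pairwise_iff_pointwiseConj Φ ha hb]
  exact not_pointwiseConj_of_shared_subfield ea eb

end Shared

end Summit.HodgeConjecture.CorCM

end
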